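import Literature.AnabelianGeometry.EtaleTheta.ThetaCoversModelPiC
import Literature.AnabelianGeometry.EtaleTheta.Discharge.Sec2InversionProofs
import Literature.AnabelianGeometry.EtaleTheta.Discharge.Sec2DoubleCoverProofs
import HarnessLib

/-!
# [EtTh] §2 at the §1 MODEL, phase 2a: `CoverDataAx` of an [EtTh] §1 theta setting, and Prop. 2.2
# (i)(ii)(iii) INSTANTIATED at it (merge row W3-L2-02 / P2-a)

Mochizuki, *The étale theta function …* [EtTh], Publ. RIMS **45** (2009), §2, Def. 2.1 and its
preamble, PRIMS PDF pp. 35–36 (printed pp. 261–262), and Prop. 2.2 (i)–(iii) p. 37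
[cite: MochizukiEtTh2009, Prop 2.2 p.37]. Layer L2 of the abc-iut cell (seat abc-iut-L2-t10, gen 4;
L2-lead RULING 2026-08-26T02:06:46Z / GO 02:37:36Z; abc-iut-L2-d3's census `W3-L2-02-CENSUS.md` §3).

abc-iut-L2-t2's interfaces `ThetaCovers.CoverData` (ThetaCovers.lean, REPAIRED v3: field
`isClosed_barKer`, GAP-LEDGER G-L2d3-5) and `ThetaCovers.CoverDataAx` (ThetaCoversAxioms.lean) had NO
instance over the arithmetic [EtTh] objects; every theorem over them — in particular abc-iut-L2-t10's
Prop. 2.2 discharges `CoverDataAx.prop22_i_holds` (p406577), `prop22_ii_holds`, `prop22_iii_holds`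
(p407791) — was an implication without a genuine instance (FACT-LIST F-0596–0599 rider; the toy
`ThetaCoversHeisenbergWitness` of abc-iut-w5-d243 is a CONSISTENCY witness only). This file builds
**`ThetaSetting.PiCData.coverDataAx`**: the `CoverDataAx` of a theta setting `D` from
* the §1 data: `Π_X = D.PiHat` ⊇ `Δ_X = D.DeltaHat` (free profinite on two generators by the guard
  `IsEtThOrigin`, carried as (P5) of abc-iut-L2-t7's `OncePuncturedData` `e`, which also gives (P1)
  `Ker(Π_X → G_K) = Δ_X`, a cusp `x` and (P4) `D_x ↠ G_K`);
* phases 1a/2a of this seat: `barKer`, `barTheta` ⊴ `Π_C` with `[barTheta : barKer] = l` (`l` odd),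
  `Δ_X/barTheta ≅ (ℤ/l)²`, centrality, `l`-th powers, closedness — all PROVED;
* the INPUT bundle `I : D.PiCData PiC` (census P-C1/P-C2: the profinite `Π_C ⊇ Π_X`, normal of index `2`,
  with augmentation; GAP-LEDGER G-L2t10-2);
* and exactly two printed inputs that no §1 structure carries, as NAMED HYPOTHESIS BINDERS (D-0067: no
  new Prop fact): **P-C3** `hIx : (D_x ∩ Δ_C) · barKer = barTheta` ("which maps the inertia group
  `I_x ⊆ D_x` isomorphically onto `Δ̄_Θ`", p. 35; GAP-LEDGER G-L2t10-3) and **P-C4** `hιell`/`hιtheta`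
  ("`ι` acts on `Q` by multiplication by `−1`", Rmk. 2.1.1 p. 36; eigenvalues `−1` on `Δ̄^ell_X` and `1`
  on `Δ̄_Θ`, Prop. 2.2 (i) p. 37 — the second is derivable from the first by the commutator pairing,
  not done here; GAP-LEDGER G-L2t10-4).
Then `prop22_i_ofSetting`, `prop22_ii_ofSetting`, `prop22_iii_ofSetting`: abc-iut-L2-t2's named facts
`CoverData.Prop22_i/ii/iii` HOLD for this instance — Prop. 2.2 at the arithmetic model, modulo the
binders listed. HONEST FRAMING: a construction + kernel-checked instantiations; the input bundle and the
three binders are NOT asserted to be satisfiable here; [EtTh] is refereed; no side is taken on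
[IUTchIII] Cor. 3.12; typed ≠ proved elsewhere.
-/

noncomputable section

namespace Literature.AnabelianGeometry.EtaleTheta

namespace ThetaSetting

namespace PiCData

open Literature.AnabelianGeometry.SemiGraphs ThetaCovers

variable {p : ℕ} [Fact p.Prime] {D : ThetaSetting p} {PiC : Type} [Group PiC] [TopologicalSpace PiC]
  [IsTopologicalGroup PiC] [T2Space PiC] (I : D.PiCData PiC) (l : ℕ)

/-- **The `CoverDataAx` of an [EtTh] §1 theta setting** (Def. 2.1 data of `C = X/{±1}` ⊇ `X`, pp. 35–36,
with the Prop. 2.2 supplement of `ThetaCoversAxioms`): `Π_C` and `Π_X ↪ Π_C ↠ G_K` from the input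
bundle `I`; `Ker(Δ_X ↠ Δ̄_X) ≤ Δ̄_Θ`-preimage `≤ Δ_X` = this seat's `barKer`/`barTheta` (normal in `Π_C`,
closed, `[barTheta : barKer] = l`, `Δ_X/barTheta ≅ (ℤ/l)²`, central, exponent `l` — PROVED in phases
1a/2a under the guard `IsEtThOrigin` of `e`); `D_x` = the closure of the decomposition group of the cusp
`x`, onto `G_K` by (P4); and the printed inputs P-C3 (`hIx`: "`I_x ⥲ Δ̄_Θ`", p. 35) and P-C4 (`hιell`,
`hιtheta`: `ι` acts by `−1` on `Δ̄^ell_X`, by `+1` on `Δ̄_Θ`, pp. 36–37) as hypotheses.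
[cite: MochizukiEtTh2009, Def 2.1 p.36] -/
def coverDataAx (e : D.OncePuncturedData) {x : D.Pt} (hx : D.IsCusp x) (hodd : Odd l)
    (hIx : (I.Dx x ⊓ I.augGK.ker) ⊔ I.barKer l = I.barTheta l)
    (hιell : ∀ c ∈ I.augGK.ker, c ∉ I.PiX → ∀ d ∈ I.PiX ⊓ I.augGK.ker, c * d * c⁻¹ * d ∈ I.barTheta l)
    (hιtheta : ∀ c ∈ I.augGK.ker, c ∉ I.PiX → ∀ t ∈ I.barTheta l, c * t * c⁻¹ * t⁻¹ ∈ I.barKer l) :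
    CoverDataAx.{0} l :=
  haveI : NeZero l := ⟨by obtain ⟨k, hk⟩ := hodd; omega⟩
  haveI : (I.barTheta l).Normal := I.barTheta_normal l e
  { l_odd := hodd
    PiC := PiC
    GK := ↥D.GK
    aug := I.augGK
    PiX := I.PiX
    PiX_normal := I.range_normal
    index_PiX := I.index_range
    isOpen_PiX := I.isOpen_PiX
    aug_PiX_surjective := I.augGK_PiX_surjective
    barKer := I.barKer l
    barKer_normal := I.barKer_normal l e
    isClosed_barKer := I.isClosed_barKer l
    barTheta := I.barTheta l
    barTheta_normal := I.barTheta_normal l e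
    barKer_le_barTheta := I.barKer_le_barTheta l e
    barTheta_le := I.barTheta_le l e
    relIndex_barKer := I.relIndex_barKer l e hodd
    ell_rank_two := I.ell_rank_two l e
    barTheta_central := I.barTheta_central l e
    Dx := I.Dx x
    Dx_le := I.Dx_le x
    aug_Dx_surjective := I.augGK_Dx_surjective e hx
    inertia_sup_barKer := hIx
    pow_mem_barKer := fun _ hd => I.pow_mem_barKer l e hd
    inv_ell := hιell
    inv_theta := hιtheta }

/-- The underlying `CoverData` of `coverDataAx` has `Π_C = PiC`, `Π_X = I.PiX`, `barKer = I.barKer l`,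
`barTheta = I.barTheta l`, `D_x = I.Dx x` (definitional bookkeeping for consumers).
[cite: MochizukiEtTh2009, Def 2.1 p.36] -/
theorem coverDataAx_barTheta (e : D.OncePuncturedData) {x : D.Pt} (hx : D.IsCusp x) (hodd : Odd l)
    (hIx : (I.Dx x ⊓ I.augGK.ker) ⊔ I.barKer l = I.barTheta l)
    (hιell : ∀ c ∈ I.augGK.ker, c ∉ I.PiX → ∀ d ∈ I.PiX ⊓ I.augGK.ker, c * d * c⁻¹ * d ∈ I.barTheta l)
    (hιtheta : ∀ c ∈ I.augGK.ker, c ∉ I.PiX → ∀ t ∈ I.barTheta l, c * t * c⁻¹ * t⁻¹ ∈ I.barKer l) :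
    (I.coverDataAx l e hx hodd hIx hιell hιtheta).barTheta = I.barTheta l ∧
      (I.coverDataAx l e hx hodd hIx hιell hιtheta).barKer = I.barKer l ∧
      (I.coverDataAx l e hx hodd hIx hιell hιtheta).Dx = I.Dx x :=
  ⟨rfl, rfl, rfl⟩

/-! ### Prop. 2.2 (i)(ii)(iii) at the model -/

/-- **[EtTh] Prop. 2.2 (i) (the inversion automorphism: eigenspace decomposition
`Δ̄_X̲ ≅ Δ̄^ell_X̲ × Δ̄_Θ`) HOLDS at the arithmetic model** — abc-iut-L2-t2's named fact `CoverData.Prop22_i`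
for the `CoverData` of an [EtTh] §1 theta setting, by abc-iut-L2-t10's discharge
`CoverDataAx.prop22_i_holds` (p406577) at the genuine instance `coverDataAx`; modulo the input bundle
`PiCData` and the printed binders P-C3/P-C4. [cite: MochizukiEtTh2009, Prop 2.2(i) p.37] -/
theorem prop22_i_ofSetting (e : D.OncePuncturedData) {x : D.Pt} (hx : D.IsCusp x) (hodd : Odd l)
    (hIx : (I.Dx x ⊓ I.augGK.ker) ⊔ I.barKer l = I.barTheta l)
    (hιell : ∀ c ∈ I.augGK.ker, c ∉ I.PiX → ∀ d ∈ I.PiX ⊓ I.augGK.ker, c * d * c⁻¹ * d ∈ I.barTheta l)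
    (hιtheta : ∀ c ∈ I.augGK.ker, c ∉ I.PiX → ∀ t ∈ I.barTheta l, c * t * c⁻¹ * t⁻¹ ∈ I.barKer l) :
    (I.coverDataAx l e hx hodd hIx hιell hιtheta).toCoverData.Prop22_i :=
  (I.coverDataAx l e hx hodd hIx hιell hιtheta).prop22_i_holds

/-- **[EtTh] Prop. 2.2 (ii) (`D_x ⥲ Π_X̲/Im(s_ι)`; the covering `X̲̲`) HOLDS at the arithmetic model** —
`CoverData.Prop22_ii` for `coverDataAx`, by `CoverDataAx.prop22_ii_holds` (p407791).
[cite: MochizukiEtTh2009, Prop 2.2(ii) p.37] -/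
theorem prop22_ii_ofSetting (e : D.OncePuncturedData) {x : D.Pt} (hx : D.IsCusp x) (hodd : Odd l)
    (hIx : (I.Dx x ⊓ I.augGK.ker) ⊔ I.barKer l = I.barTheta l)
    (hιell : ∀ c ∈ I.augGK.ker, c ∉ I.PiX → ∀ d ∈ I.PiX ⊓ I.augGK.ker, c * d * c⁻¹ * d ∈ I.barTheta l)
    (hιtheta : ∀ c ∈ I.augGK.ker, c ∉ I.PiX → ∀ t ∈ I.barTheta l, c * t * c⁻¹ * t⁻¹ ∈ I.barKer l) :
    (I.coverDataAx l e hx hodd hIx hιell hιtheta).toCoverData.Prop22_ii :=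
  (I.coverDataAx l e hx hodd hIx hιell hιtheta).prop22_ii_holds

/-- **[EtTh] Prop. 2.2 (iii) (the coset where `ι` has order `2`; the double covering `X̲̲ → C̲̲`) HOLDS
at the arithmetic model** — `CoverData.Prop22_iii` for `coverDataAx`, by `CoverDataAx.prop22_iii_holds`
(p407791). [cite: MochizukiEtTh2009, Prop 2.2(iii) p.37] -/
theorem prop22_iii_ofSetting (e : D.OncePuncturedData) {x : D.Pt} (hx : D.IsCusp x) (hodd : Odd l)
    (hIx : (I.Dx x ⊓ I.augGK.ker) ⊔ I.barKer l = I.barTheta l)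
    (hιell : ∀ c ∈ I.augGK.ker, c ∉ I.PiX → ∀ d ∈ I.PiX ⊓ I.augGK.ker, c * d * c⁻¹ * d ∈ I.barTheta l)
    (hιtheta : ∀ c ∈ I.augGK.ker, c ∉ I.PiX → ∀ t ∈ I.barTheta l, c * t * c⁻¹ * t⁻¹ ∈ I.barKer l) :
    (I.coverDataAx l e hx hodd hIx hιell hιtheta).toCoverData.Prop22_iii :=
  (I.coverDataAx l e hx hodd hIx hιell hιtheta).prop22_iii_holds

end PiCData

end ThetaSetting

end Literature.AnabelianGeometry.EtaleTheta

end
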